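/-
Copyright: b2b-lace cell (CriticalPhenomena). Text-final: enum1-g74 desk draft 2 (8d1c46f8aaa8e264; = enum1-g73 desk draft 1
0be04ee1f6470bd6 with §A–§D byte-identical + the tree import `NobleEntryAbarIotaStZeroTwo` + §E "the direction `ι` summed
inside (class 2)") + header relabel ONLY (no swap, no further import), filed by the enum1 seat under REFEREE v219 R1416 and
ORDERS v222 (b) (the T2 leaves after T1, T3-RIGHT, T3-LEFT; T2-RIGHT first, separate boundaries) after `NobleWeightedDiagSplit`,
`NobleWeightedDiagRight` and `NobleWeightedDiagLeft` landed and were built.  Off-diagonal halves `t ≠ e_ι` of the left-trivial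
pieces `b = 1, 2`: split of weight, displaced bubbles, product bounds, the direction sum inside the displaced bubbles (§E).
No numeral; d-generic; no cited hypothesis.
-/
import Literature.Probability.FitznerVanDerHofstad2017.NobleWeightedDiagRight
import Literature.Probability.FitznerVanDerHofstad2017.NobleWeightedDiagLeft
import Literature.Probability.FitznerVanDerHofstad2017.NobleEntryAbarIotaStZeroTwo
import HarnessLib

/-!
# [FvdH17] App. C.1, left-trivial diagram: the OFF-DIAGONAL half `t ≠ e_ι` of the pieces `R_L(ι,b)`, `b = 1, 2`

CITATION HEADER (PLACEMENT v2). This module is part of a certified REPRODUCTION of: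
R. Fitzner, R. van der Hofstad, *Mean-field behavior for nearest-neighbor percolation in `d > 10`*, Electron. J.
Probab. **22** (2017) no. 43 [FvdH17] (arXiv:1506.07977v2): App. C.1 "Improvement of differences: Split of weight",
display (C.1) and the left-trivial sentence at the top of p. 80 ("bounded in the same way, with the exception that the
special case `z = x` … does not need to be considered") (pp. 79–80); App. B, Tables "definition of `P^b`" (p. 73),
"definition of `A^{ι,a,b}`" (p. 75), display "double-open triangle `Ā^{ι,a,b}`" (p. 78); §5.1 Table `P^{E,b}` (p. 47);
§4.4 (4.65) (p. 43); Lemma 5.1, second version (p. 50); §4.2 (4.1), (4.3), (4.7)–(4.10), Def. 4.1 (4.14)–(4.17)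
(pp. 34–36); §5.1 "Elements of the bounds" (p. 49); §5.2 (Hi-defs) and the display after (HD-def) (p. 50); §3.5 "Symmetry
of the model" (p. 32).  Origin: build `lace` (host summit CriticalPhenomena); node N76, leaf T2, §F
(off-diagonal leaves, LEFT side) — the sibling of `NobleWeightedOffDiagRight` (§A–§E, right side).

WHAT THIS FILE DOES.  `NobleWeightedDiagSplit` splits each left-trivial piece `rawLPiece Ab En ι b` (`u = w = 0`;
`b = 1, 2`) of the weighted `N = 1` coefficient into the DIAGONAL addend `rawLDiag` (exit vertex `t = e_ι`) and the
OFF-DIAGONAL addend `rawLOffDiag = Σ_{x,t,z} ‖x‖₂² (1−δ_{t,e_ι}) Ā'^{ι,0,b}(0,0,t,z) (P^E−u⃗)_b(t−x, z−x)`.  This file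
treats ONLY the off-diagonal addend, for the middle table `Ā'` (`blockAbar'`) and the exit letters `P^E−u⃗` (`blockPEn`).
THE LEFT DIAGRAM.  Row `Ā^{ι,0,2}(0,0,t,z) = T*_{1,1̲,0}(−z, e_ι−z, t−z) = τ₁(−z)·τ_{1̲}(e_ι)·τ_{≥0}(t−e_ι)` (App. B p. 78,
the NON-repulsive letter of print's table; tree `blockAbar₀_zero_two`) is the path `z → 0 → e_ι → t`; the exit letter
`(P^E−u⃗)_2(t−x,z−x) = (1−δ)(1−δ)𝓣_{1,2,1}(t−x,z−x,0)` is the closed repulsive triangle on `x, t, z` whose doubled side is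
`t =2= z`.  The loop `0 –bond– e_ι –line– t =dbl= z –line– 0` carries the bond and the doubled line OPPOSITE each other
(in App. C.1 Case d) they are adjacent): print's "in the same way" is a statement of METHOD (split of weight, product
bounds), which is what is typed here — no letter of (C.2)–(C.5) is asserted for the left pieces.
* §A (every letter table `L`): the rows `(0,2)` and `(0,1)` of `Ā'` at `u = w = 0` (`blockAbar'_zero_two_left`; the
  mask `(1−δ_{t,e_ι})` kills exactly the Kronecker addend `δ_{t,e}𝓣_{1̲,1̲,2}` of row `(0,1)`:
  `mask_mul_blockAbar'_zero_one_left`); the split of weight through `z` — the vertex joined to BOTH `0` and `x` by single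
  lines — `‖x‖₂² ≤ 2‖z‖₂² + 2‖z−x‖₂²` (`rawLOffDiag_le_two_split`); ONE reindexing `(x,t,z) ↦ (s := z−t, z, w := z−x)`
  (`tsum₃_exit_reindex`) after which the exit triangle appears through the objects of the diagonal modules:
  `diagLTT L j s` (unweighted, `NobleWeightedDiagLeft`) and `Σ_w ‖w‖₂² F_j(s;w)` = `diagWTT`∕`diagWTB`
  (`NobleWeightedDiagRight`) — the weight on the exit line `{z ↔ x}`.
* §B (percolation): off the diagonal `τ_{≥0}(t−e_ι) = τ_{≥1}(t−e_ι)` ((4.1): distinct endpoints;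
  `perc_tau_geZero_eq_geOne_of_ne`); the `z`-sums of the left path are, EXACTLY, the shifted bubbles
  `Σ_z (1−δ_{z−s,e})‖z‖₂²τ₁(z)τ₁(z−s−e_ι) = Φ(s+e_ι)` (`wtOpenBubbleAt`) and `… = Φ⁰(s+e_ι)` (`openBubbleAt`) — the
  masked point carries `τ_{≥1}(0) = 0`.
* §C (percolation, class `b = 2`): `rawLOffDiag (Ā') (P^E−u⃗) ι 2 ≤ 2p·Σ_s TT₂(s)·Φ(s+e_ι) + 2p·Σ_s WTT(s)·Φ⁰(s+e_ι)`
  (the two terms as IDENTITIES `perc_offDiagL_two_termW_eq`, `perc_offDiagL_two_termX_eq`; only the split of weight is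
  an inequality), and the product form `≤ 2p·Σ_s τ₂(s)·(Φ⁰(s)Φ(s+e_ι) + Φ(s)Φ⁰(s+e_ι))` (`𝓣 ≤ 𝓣*` on the exit letter).
  The index `≥ 2` sits on `s = z − t`, the exit triangle's doubled side — the only `≥ 2` line of the diagram.
* §D (percolation, class `b = 1`): the same with `τ_{1̲}(s)` in place of `p` (`𝓢 ≤ 𝓢*`, `p⁻¹·p ≤ 1`; `|s| = 1` forced):
  `rawLOffDiag (Ā') (P^E−u⃗) ι 1 ≤ 2·Σ_s τ_{1̲}(s)·(TT_{1̲}(s)·Φ(s+e_ι) + WTB(s)·Φ⁰(s+e_ι)) ≤ 2·Σ_s τ_{1̲}(s)²·(…)`.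
* §E (class `b = 2`; the direction `ι` of (4.65) summed INSIDE the displaced bubbles): for every letter table `L`
  (IDENTITIES — the reindexing `ι ↦ opp ι` of the finite direction sum only) `p·Σ_ι τ_{≥1}(w − (s+e_ι)) = K̃_L(w−s)` with
  `K̃_L(y) = p Σ_ι τ_{≥1}(y+e_ι)` (`NobleWeightedDiagLeft.diagKtilde`; `p_mul_sum_tau_sub_add_stepVec`), hence
  `Σ_ι p Φ_L(s+e_ι) = Φ^K_L(s) := Σ_w ‖w‖₂² τ₁(w) K̃_L(w−s)` (`wtKBubbleAt`, `sum_p_mul_wtOpenBubbleAt_add_stepVec`) and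
  `Σ_ι p Φ⁰_L(s+e_ι) = Φ^{K,0}_L(s) := Σ_w τ₁(w) K̃_L(w−s)` (`kBubbleAt`, `sum_p_mul_openBubbleAt_add_stepVec`) — the open
  bubble whose second line is followed by the pivotal bond and one more line of length `≥ 1`, in PRODUCT form
  (`τ₁ · p · τ_{≥1}`, the non-repulsive `T*` of row `Ā^{ι,0,2}`), NOT the repulsive letter `H₂`; at `L = Letters.perc d p`:
  `Σ_ι rawLOffDiag (Ā') (P^E−u⃗) ι 2 ≤ 2 Σ_s TT₂(s) Φ^K(s) + 2 Σ_s WTT(s) Φ^{K,0}(s)` (`perc_sum_rawLOffDiag_two_le_dir`; the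
  exit letters `TT₂ = diagLTT (≥2)`, `WTT = diagWTT` kept WHOLE) `≤ 2 (sup_{s≠0} Φ^K(s)) Σ_s TT₂(s) + 2 Σ_s τ₂(s) Φ(s) Φ^{K,0}(s)`
  (`perc_sum_rawLOffDiag_two_le_sup`: `TT₂(0) = 0` — a point-to-itself line of length `≥ 2` does not exist — so the member
  `s = 0` drops BEFORE the supremum `wtKBubbleSup = sup_{s≠0} Φ^K(s)` is taken; `WTT(s) ≤ τ₂(s) Φ(s)` is
  `NobleWeightedDiagRight.perc_diagWTT_le`); and the pricing sentences for `K̃` on the real side (`1 ≤ d`):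
  `K̃(v) = 2dp (D ⋆ τ_{≥1,p})(v)` exactly (the direction sum is the neighbour sum; `perc_diagKtilde_eq_ofReal`) and
  `K̃(v) ≤ (2dp)² (D ⋆ D ⋆ τ_p)(v)` ((4.3) on each of the `2d` lines; `perc_diagKtilde_le_ofReal`).  Only `𝓣 ≤ 𝓣*` and (4.3)
  are used as inequalities between letters of print in §E; the rest is algebra over the tree's objects (finite
  reindexing, Fubini for non-negative series, `sup`-extraction).
No supremum is extracted per direction `ι` (§A–§D): the shift makes `s + e_ι = 0` unavoidable, so `sup_{s≠0}` does not
apply on the left BEFORE the direction sum; the `s`-sums are the objects.  After the direction sum (§E) it does.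

DIAGONAL CONVENTION (GAPS G-D98).  Every statement here is about the off-diagonal addend `rawLOffDiag` ALONE; the
diagonal addend `rawLDiag` (`t = e_ι`: the third factor is `τ_{≥0}(0)`, the trivial line) is carried separately
(`NobleWeightedDiagLeft`) and is NOT bounded by anything in this file.  App. C.1 is cited as the locator of the METHOD
(split of weight) for the off-diagonal addend only.  No numeral; nothing landed is modified; no cited hypothesis.
-/

noncomputable section

namespace Literature.Probability.FitznerVanDerHofstad2017

open scoped BigOperators ENNReal
open Literature.Probability.LatticeModels Literature.Probability.Percolation
open Literature.Probability.FitznerVanDerHofstad2017.BlockSummation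
open Literature.Probability.FitznerVanDerHofstad2017.NobleBlocks

variable {d : ℕ}

local notation "𝐞" => Literature.Probability.Percolation.stepVec

/-! ## A. Rows, split of weight and the reindexing (every letter table `L`) -/

/-- **Row `(0,2)` of `Ā'^ι = Ā^ι` at the left-trivial position `u = w = 0`**, unfolded:
`Ā^{ι,0,2}(0,0,t,z) = T*_{1,1̲,0}(−z, e_ι−z, t−z) = τ_{≥1}(−z) · τ_{1̲}(e_ι) · τ_{≥0}(t − e_ι)` (the path `z → 0 → e_ι → t`).
(G-D98-neutral: a row identity of the letter table, independent of the diagonal split.)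
[cite: FitznerVanDerHofstad2017, App. B, display "double-open triangle Ā^{ι,a,b}", row Ā^{ι,0,2} (arXiv:1506.07977v2 p. 78); §4.2 (4.7)–(4.8) (p. 34)] -/
theorem blockAbar'_zero_two_left (L : Letters d) (ι : Fin d × Bool) (t z : Site d) :
    blockAbar' L ι 0 2 0 0 t z = L.tau (.ge 1) (-z) * (L.tau (.eq 1) (𝐞 ι) * L.tau (.ge 0) (t - 𝐞 ι)) := by
  rw [blockAbar'_of_ne L ι (by decide), blockAbar, ofBase]
  simp only [sub_zero]
  rw [blockAbar₀_zero_two, kd_self, one_mul]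
  simp only [Letters.Tst, Letters.Bst, sub_neg_eq_add, sub_add_cancel, sub_sub_sub_cancel_right, mul_assoc]

/-- **Row `(0,1)` of `Ā'^ι = Ā^ι = (1/p)A^ι` at `u = w = 0`, OFF the diagonal `t = e_ι`**: the mask `(1−δ_{t,e_ι})` kills
the Kronecker addend `δ_{t,e} 𝓣_{1̲,1̲,2}(e,z,0)` of the row `A^{ι,0,1}(0,v,x,y) = δ_{0,v}(1−δ_{y,v})(δ_{x,e}𝓣_{1̲,1̲,2}(e,y,0)
+ 𝓢_{1̲,1,1̲,1}(e,x,y,0))`, leaving `(1−δ_{t,e}) · p⁻¹ · (1−δ_{z,0}) · 𝓢_{1̲,1,1̲,1}(e_ι,t,z,0)` (the square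
`0 –bond– e_ι –line– t –bond– z –line– 0`).
(GAPS G-D98: the off-diagonal addend `rawLOffDiag` only — the diagonal `t = 𝐞 ι` is the separate addend `rawLDiag`,
carried and priced on its own, and is not bounded here.)
[cite: FitznerVanDerHofstad2017, App. B Table "definition of A^{ι,a,b}", row a=0,b=1 (arXiv:1506.07977v2 p. 75); display "Ā^{ι,a,1} = (1/p) A^{ι,a,1}" (p. 78)] -/
theorem mask_mul_blockAbar'_zero_one_left (L : Letters d) (ι : Fin d × Bool) (t z : Site d) :
    kdc t (𝐞 ι) * blockAbar' L ι 0 1 0 0 t z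
      = kdc t (𝐞 ι) * (L.p⁻¹ * (kdc z 0 * L.S (.eq 1) (.ge 1) (.eq 1) (.ge 1) (𝐞 ι) t z 0)) := by
  rw [blockAbar'_of_ne L ι (by decide), blockAbar, ofBase]
  simp only [sub_zero]
  rw [show blockAbar₀ L ι 0 1 0 t z = L.p⁻¹ * (kd (0 : Site d) 0 * kdc z 0 *
      (kd t (𝐞 ι) * L.T (.eq 1) (.eq 1) (.ge 2) (𝐞 ι) z 0 + L.S (.eq 1) (.ge 1) (.eq 1) (.ge 1) (𝐞 ι) t z 0)) from rfl,
    kd_self, one_mul]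
  by_cases ht : t = 𝐞 ι
  · subst ht
    rw [kdc_self, zero_mul, zero_mul]
  · rw [kd_of_ne ht, zero_mul, zero_add]

/-- **Split of weight through `z`** for the off-diagonal left piece: `‖x‖₂² ≤ 2‖z‖₂² + 2‖z−x‖₂²` under the sum
(`z` is joined to `0` by the line of the left path and to `x` by a line of the exit triangle).
(Letter-free weight algebra, generic in every family `Ab`, `En` — applied below to `Ā'`, `P^E−u⃗` only; the statement
is on the OFF-diagonal addend, not on a whole piece of (4.65).)
(GAPS G-D98: the off-diagonal addend `rawLOffDiag` only — the diagonal `t = 𝐞 ι` is the separate addend `rawLDiag`,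
carried and priced on its own, and is not bounded here.)
[cite: FitznerVanDerHofstad2017, App. C.1 "Split of weight", (C.1) and the left-trivial sentence (arXiv:1506.07977v2 pp. 79–80); §4.4 (4.65) (p. 43)] -/
theorem rawLOffDiag_le_two_split (Ab : DirBlockFamily d) (En : Fin 3 → Site d → Site d → ℝ≥0∞)
    (ι : Fin d × Bool) (b : Fin 3) :
    rawLOffDiag Ab En ι b ≤
      2 * (∑' x, ∑' t, ∑' z, wt z * (kdc t (𝐞 ι) * (Ab ι 0 b 0 0 t z * En b (t - x) (z - x)))) +
        2 * (∑' x, ∑' t, ∑' z, wt (z - x) * (kdc t (𝐞 ι) * (Ab ι 0 b 0 0 t z * En b (t - x) (z - x)))) := by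
  unfold rawLOffDiag
  calc ∑' x, ∑' t, ∑' z, wt x * (kdc t (𝐞 ι) * (Ab ι 0 b 0 0 t z * En b (t - x) (z - x)))
      ≤ ∑' x, ∑' t, ∑' z, 2 * (wt z + wt (z - x)) * (kdc t (𝐞 ι) * (Ab ι 0 b 0 0 t z * En b (t - x) (z - x))) :=
        ENNReal.tsum_le_tsum fun x => ENNReal.tsum_le_tsum fun t => ENNReal.tsum_le_tsum fun z =>
          mul_le_mul' (wt_le_two_split_left x z) le_rfl
    _ = _ := by
        simp only [mul_add, add_mul, mul_assoc, ENNReal.tsum_add, ENNReal.tsum_mul_left]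

/-- **The reindexing `(x,t,z) ↦ (s, z, w) := (z−t, z, z−x)`** of a left off-diagonal term: for any weight `Λ(x,z)`, any
left factor `F(t,z)` and the exit letter of middle index `j` in `(1−δ)`-form,
`Σ_{x,t,z} Λ(x,z) F(t,z) (1−δ_{z−x,0})(1−δ_{t−x,0}) 𝓣_{1,j,1}(t−x,z−x,0) = Σ_s Σ_z F(z−s,z) Σ_w Λ(z−w,z) F_j(s;w)`
(`F_j(s;w) = diagLIntegrand L j s w`, the exit-triangle integrand of `NobleWeightedDiagLeft`).
(G-D98-neutral: a reindexing identity, independent of the diagonal split.)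
[cite: FitznerVanDerHofstad2017, §4.4 (4.65) (arXiv:1506.07977v2 p. 43); Lemma 5.1 second version (p. 50)] -/
theorem tsum₃_exit_reindex (L : Letters d) (j : LenIdx) (Λ F : Site d → Site d → ℝ≥0∞) :
    ∑' x, ∑' t, ∑' z, Λ x z * (F t z * (kdc (z - x) 0 * (kdc (t - x) 0 * L.T (.ge 1) j (.ge 1) (t - x) (z - x) 0)))
      = ∑' s, ∑' z, F (z - s) z * ∑' w, Λ (z - w) z * diagLIntegrand L j s w := by
  have h1 : ∑' x, ∑' t, ∑' z, Λ x z * (F t z * (kdc (z - x) 0 * (kdc (t - x) 0 * L.T (.ge 1) j (.ge 1) (t - x) (z - x) 0)))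
      = ∑' z, ∑' t, ∑' x, Λ x z * (F t z * (kdc (z - x) 0 * (kdc (t - x) 0 * L.T (.ge 1) j (.ge 1) (t - x) (z - x) 0))) := by
    rw [ENNReal.tsum_comm]
    refine (tsum_congr fun t => ENNReal.tsum_comm).trans ?_
    rw [ENNReal.tsum_comm]
  have h2 : ∀ z t : Site d,
      ∑' x, Λ x z * (F t z * (kdc (z - x) 0 * (kdc (t - x) 0 * L.T (.ge 1) j (.ge 1) (t - x) (z - x) 0)))
        = F t z * ∑' w, Λ (z - w) z * (kdc w 0 * (kdc (t - (z - w)) 0 * L.T (.ge 1) j (.ge 1) (t - (z - w)) w 0)) := by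
    intro z t
    have hx : ∑' x, Λ x z * (F t z * (kdc (z - x) 0 * (kdc (t - x) 0 * L.T (.ge 1) j (.ge 1) (t - x) (z - x) 0)))
        = ∑' w, Λ (z - w) z * (F t z * (kdc w 0 * (kdc (t - (z - w)) 0 * L.T (.ge 1) j (.ge 1) (t - (z - w)) w 0))) := by
      rw [← (Equiv.subLeft z).tsum_eq]
      refine tsum_congr fun w => ?_
      simp only [Equiv.subLeft_apply, sub_sub_cancel]
    rw [hx, ← ENNReal.tsum_mul_left]
    exact tsum_congr fun w => by ring
  have h3 : ∀ z : Site d,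
      ∑' t, F t z * ∑' w, Λ (z - w) z * (kdc w 0 * (kdc (t - (z - w)) 0 * L.T (.ge 1) j (.ge 1) (t - (z - w)) w 0))
        = ∑' s, F (z - s) z * ∑' w, Λ (z - w) z * diagLIntegrand L j s w := by
    intro z
    have ht : ∑' t, F t z * ∑' w, Λ (z - w) z * (kdc w 0 * (kdc (t - (z - w)) 0 * L.T (.ge 1) j (.ge 1) (t - (z - w)) w 0))
        = ∑' s, F (z - s) z * ∑' w, Λ (z - w) z *
            (kdc w 0 * (kdc (z - s - (z - w)) 0 * L.T (.ge 1) j (.ge 1) (z - s - (z - w)) w 0)) := by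
      rw [← (Equiv.subLeft z).tsum_eq]
      exact tsum_congr fun s => by simp only [Equiv.subLeft_apply]
    rw [ht]
    refine tsum_congr fun s => ?_
    congr 1
    refine tsum_congr fun w => ?_
    rw [show z - s - (z - w) = w - s by abel, diagLIntegrand]
  rw [h1]
  simp only [h2, h3]
  rw [ENNReal.tsum_comm]

/-! ## B. Percolation: the left path off the diagonal, and its `z`-sums -/

section Perc

variable (p : unitInterval)

/-- `τ_{≥1}(0) = 0`: `{v ←1→ v} = ∅`. [folklore] -/
private theorem perc_tau_geOne_zero' : (Letters.perc d p).tau (.ge 1) (0 : Site d) = 0 := by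
  rw [perc_tau, LenIdx.event_self_eq_empty (j := .ge 1) one_ne_zero, _root_.MeasureTheory.measure_empty]

/-- **A line between distinct points has length `≥ 1`, at the level of `τ`**: `τ_{≥0}(x) = τ_{≥1}(x)` for `x ≠ 0`
(`{0 ←0→ x} = {0 ↔ x} = {0 ←1→ x}`: every occupied path between distinct points has at least one step).
(G-D98-neutral: a letter identity independent of the diagonal split.)
[cite: FitznerVanDerHofstad2017, §4.2 (4.1) (arXiv:1506.07977v2 p. 34)] -/
theorem perc_tau_geZero_eq_geOne_of_ne {x : Site d} (hx : x ≠ 0) :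
    (Letters.perc d p).tau (.ge 0) x = (Letters.perc d p).tau (.ge 1) x := by
  rw [perc_tau, perc_tau, LenIdx.event_ge, LenIdx.event_ge, openConnGe_zero, openConnGe_one_eq hx.symm]

/-- **Row `(0,2)` off the diagonal, evaluated**: `(1−δ_{t,e_ι}) Ā^{ι,0,2}(0,0,t,z) = (1−δ_{t,e_ι}) · p · τ₁(z) · τ₁(t−e_ι)`
(`τ_{1̲}(e_ι) = p`, `τ₁(−z) = τ₁(z)`, and `τ_{≥0}(t−e_ι) = τ_{≥1}(t−e_ι)` for `t ≠ e_ι`).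
(GAPS G-D98: the off-diagonal addend `rawLOffDiag` only — the diagonal `t = 𝐞 ι` is the separate addend `rawLDiag`,
carried and priced on its own, and is not bounded here.)
[cite: FitznerVanDerHofstad2017, App. B, display "double-open triangle Ā^{ι,a,b}", row Ā^{ι,0,2} (arXiv:1506.07977v2 p. 78); §4.2 (4.1), (4.7)–(4.8) (p. 34); §3.5 (p. 32)] -/
theorem perc_mask_mul_blockAbar'_zero_two_left (ι : Fin d × Bool) (t z : Site d) :
    kdc t (𝐞 ι) * blockAbar' (Letters.perc d p) ι 0 2 0 0 t z
      = kdc t (𝐞 ι) * (ENNReal.ofReal p *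
          ((Letters.perc d p).tau (.ge 1) z * (Letters.perc d p).tau (.ge 1) (t - 𝐞 ι))) := by
  rw [blockAbar'_zero_two_left, perc_tau_neg, perc_tau_eq_one_stepVec]
  by_cases ht : t = 𝐞 ι
  · subst ht
    rw [kdc_self, zero_mul, zero_mul]
  · rw [perc_tau_geZero_eq_geOne_of_ne p (sub_ne_zero.mpr ht)]
    ring

/-- **Row `(0,1)` off the diagonal, product-bounded**: `(1−δ_{t,e}) Ā^{ι,0,1}(0,0,t,z) ≤ (1−δ_{t,e}) · τ_{1̲}(z−t) · τ₁(z) · τ₁(t−e_ι)`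
(`𝓢_{1̲,1,1̲,1}(e,t,z,0) ≤ 𝓢* = τ_{1̲}(e) τ₁(t−e) τ_{1̲}(z−t) τ₁(−z)`, `p⁻¹ τ_{1̲}(e) = p⁻¹ p ≤ 1`, `τ₁(−z) = τ₁(z)`, `1−δ_{z,0} ≤ 1`).
(GAPS G-D98: the off-diagonal addend `rawLOffDiag` only — the diagonal `t = 𝐞 ι` is the separate addend `rawLDiag`,
carried and priced on its own, and is not bounded here.)
[cite: FitznerVanDerHofstad2017, App. B Table "definition of A^{ι,a,b}", row a=0,b=1 (arXiv:1506.07977v2 p. 75); §4.2 (4.9), (4.14)–(4.17) (pp. 34–36); §3.5 (p. 32)] -/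
theorem perc_mask_mul_blockAbar'_zero_one_left_le (ι : Fin d × Bool) (t z : Site d) :
    kdc t (𝐞 ι) * blockAbar' (Letters.perc d p) ι 0 1 0 0 t z
      ≤ kdc t (𝐞 ι) * ((Letters.perc d p).tau (.eq 1) (z - t) *
          ((Letters.perc d p).tau (.ge 1) z * (Letters.perc d p).tau (.ge 1) (t - 𝐞 ι))) := by
  have hS : (Letters.perc d p).S (.eq 1) (.ge 1) (.eq 1) (.ge 1) (𝐞 ι) t z 0
      ≤ ENNReal.ofReal p * (Letters.perc d p).tau (.ge 1) (t - 𝐞 ι) * (Letters.perc d p).tau (.eq 1) (z - t)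
          * (Letters.perc d p).tau (.ge 1) z := by
    refine (perc_S_le_Sst p _ _ _ _ _ _ _ _).trans_eq ?_
    simp only [Letters.Sst, Letters.Tst, Letters.Bst, zero_sub, perc_tau_neg, perc_tau_eq_one_stepVec]
  have hp : (ENNReal.ofReal (p : ℝ))⁻¹ * ENNReal.ofReal (p : ℝ) ≤ 1 := by
    by_cases h0 : ENNReal.ofReal (p : ℝ) = 0
    · rw [h0, mul_zero]; exact zero_le_one
    · exact (ENNReal.inv_mul_cancel h0 ENNReal.ofReal_ne_top).le
  rw [mask_mul_blockAbar'_zero_one_left, perc_p]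
  refine mul_le_mul' le_rfl ?_
  calc (ENNReal.ofReal (p : ℝ))⁻¹ * (kdc z 0 * (Letters.perc d p).S (.eq 1) (.ge 1) (.eq 1) (.ge 1) (𝐞 ι) t z 0)
      ≤ (ENNReal.ofReal (p : ℝ))⁻¹ * (1 * (ENNReal.ofReal p * (Letters.perc d p).tau (.ge 1) (t - 𝐞 ι)
          * (Letters.perc d p).tau (.eq 1) (z - t) * (Letters.perc d p).tau (.ge 1) z)) :=
        mul_le_mul' le_rfl (mul_le_mul' (kdc_le_one _ _) hS)
    _ = (ENNReal.ofReal (p : ℝ))⁻¹ * ENNReal.ofReal p * ((Letters.perc d p).tau (.eq 1) (z - t) *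
          ((Letters.perc d p).tau (.ge 1) z * (Letters.perc d p).tau (.ge 1) (t - 𝐞 ι))) := by ring
    _ ≤ 1 * ((Letters.perc d p).tau (.eq 1) (z - t) *
          ((Letters.perc d p).tau (.ge 1) z * (Letters.perc d p).tau (.ge 1) (t - 𝐞 ι))) := mul_le_mul' hp le_rfl
    _ = _ := one_mul _

/-- **The weighted `z`-sum of the masked left path is the shifted weighted open bubble**:
`Σ_z (1−δ_{z−s,e_ι}) τ₁(z) τ₁(z−s−e_ι) ‖z‖₂² = Φ(s + e_ι)` (the masked point `z = s + e_ι` carries `τ₁(0) = 0`).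
(GAPS G-D98: the off-diagonal addend `rawLOffDiag` only — the diagonal `t = 𝐞 ι` is the separate addend `rawLDiag`,
carried and priced on its own, and is not bounded here.)
[cite: FitznerVanDerHofstad2017, §5.1 "Elements of the bounds", weighted open bubble (arXiv:1506.07977v2 p. 49); §4.2 (4.1), (4.7) (p. 34)] -/
theorem perc_tsum_mask_tau_tau_wt (ι : Fin d × Bool) (s : Site d) :
    ∑' z, kdc (z - s) (𝐞 ι) * ((Letters.perc d p).tau (.ge 1) z * (Letters.perc d p).tau (.ge 1) (z - s - 𝐞 ι)) * wt z
      = wtOpenBubbleAt (Letters.perc d p) (s + 𝐞 ι) := by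
  unfold wtOpenBubbleAt
  refine tsum_congr fun z => ?_
  rw [sub_sub]
  by_cases hz : z = s + 𝐞 ι
  · subst hz
    rw [sub_self, perc_tau_geOne_zero', mul_zero, mul_zero, mul_zero, zero_mul]
  · rw [kdc_of_ne (fun h => hz (by rw [← h]; abel)), one_mul]
    ring

/-- **The plain `z`-sum of the masked left path is the shifted open bubble**:
`Σ_z (1−δ_{z−s,e_ι}) τ₁(z) τ₁(z−s−e_ι) = Φ⁰(s + e_ι)`.
(GAPS G-D98: the off-diagonal addend `rawLOffDiag` only — the diagonal `t = 𝐞 ι` is the separate addend `rawLDiag`,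
carried and priced on its own, and is not bounded here.)
[cite: FitznerVanDerHofstad2017, §4.2 (4.1), (4.7), (4.14)–(4.17) (arXiv:1506.07977v2 pp. 34–36)] -/
theorem perc_tsum_mask_tau_tau (ι : Fin d × Bool) (s : Site d) :
    ∑' z, kdc (z - s) (𝐞 ι) * ((Letters.perc d p).tau (.ge 1) z * (Letters.perc d p).tau (.ge 1) (z - s - 𝐞 ι))
      = openBubbleAt (Letters.perc d p) (s + 𝐞 ι) := by
  unfold openBubbleAt
  refine tsum_congr fun z => ?_
  rw [sub_sub]
  by_cases hz : z = s + 𝐞 ι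
  · subst hz
    rw [sub_self, perc_tau_geOne_zero', mul_zero, mul_zero]
  · rw [kdc_of_ne (fun h => hz (by rw [← h]; abel)), one_mul]

/-! ## C. Percolation, class `b = 2`: `rawLOffDiag (Ā') (P^E−u⃗) ι 2` -/

/-- **TERM W of class `2`, as an identity**: the `‖z‖₂²`-weighted off-diagonal left piece equals
`p · Σ_s TT₂(s) · Φ(s + e_ι)` (`TT₂ = diagLTT L (≥2)`: the unweighted exit triangle; `Φ = wtOpenBubbleAt`).
(GAPS G-D98: the off-diagonal addend `rawLOffDiag` only — the diagonal `t = 𝐞 ι` is the separate addend `rawLDiag`,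
carried and priced on its own, and is not bounded here.)
[cite: FitznerVanDerHofstad2017, App. C.1, left-trivial sentence (arXiv:1506.07977v2 p. 80); App. B pp. 73, 78; §5.1 Table "P^{E,b}" (p. 47); Lemma 5.1 second version (p. 50)] -/
theorem perc_offDiagL_two_termW_eq (ι : Fin d × Bool) :
    ∑' x, ∑' t, ∑' z, wt z * (kdc t (𝐞 ι) *
        (blockAbar' (Letters.perc d p) ι 0 2 0 0 t z * blockPEn (Letters.perc d p) 2 (t - x) (z - x)))
      = ENNReal.ofReal p *
          ∑' s, diagLTT (Letters.perc d p) (.ge 2) s * wtOpenBubbleAt (Letters.perc d p) (s + 𝐞 ι) := by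
  calc ∑' x, ∑' t, ∑' z, wt z * (kdc t (𝐞 ι) *
          (blockAbar' (Letters.perc d p) ι 0 2 0 0 t z * blockPEn (Letters.perc d p) 2 (t - x) (z - x)))
      = ∑' x, ∑' t, ∑' z, wt z * ((kdc t (𝐞 ι) * (ENNReal.ofReal p *
          ((Letters.perc d p).tau (.ge 1) z * (Letters.perc d p).tau (.ge 1) (t - 𝐞 ι)))) *
          (kdc (z - x) 0 * (kdc (t - x) 0 * (Letters.perc d p).T (.ge 1) (.ge 2) (.ge 1) (t - x) (z - x) 0))) := by
        refine tsum_congr fun x => tsum_congr fun t => tsum_congr fun z => ?_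
        rw [blockPEn_two_eq, ← mul_assoc (kdc t (𝐞 ι)), perc_mask_mul_blockAbar'_zero_two_left]
    _ = ∑' s, ∑' z, (kdc (z - s) (𝐞 ι) * (ENNReal.ofReal p *
          ((Letters.perc d p).tau (.ge 1) z * (Letters.perc d p).tau (.ge 1) (z - s - 𝐞 ι)))) *
          ∑' w, wt z * diagLIntegrand (Letters.perc d p) (.ge 2) s w :=
        tsum₃_exit_reindex (Letters.perc d p) (.ge 2) (fun _ z => wt z)
          (fun t z => kdc t (𝐞 ι) * (ENNReal.ofReal p *
            ((Letters.perc d p).tau (.ge 1) z * (Letters.perc d p).tau (.ge 1) (t - 𝐞 ι))))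
    _ = ∑' s, diagLTT (Letters.perc d p) (.ge 2) s * (ENNReal.ofReal p *
          ∑' z, kdc (z - s) (𝐞 ι) * ((Letters.perc d p).tau (.ge 1) z *
            (Letters.perc d p).tau (.ge 1) (z - s - 𝐞 ι)) * wt z) := by
        refine tsum_congr fun s => ?_
        rw [← ENNReal.tsum_mul_left, ← ENNReal.tsum_mul_left]
        refine tsum_congr fun z => ?_
        rw [ENNReal.tsum_mul_left, diagLTT]
        ring
    _ = _ := by
        rw [← ENNReal.tsum_mul_left]
        refine tsum_congr fun s => ?_
        rw [perc_tsum_mask_tau_tau_wt]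
        ring

/-- **TERM X of class `2`, as an identity**: the `‖z−x‖₂²`-weighted off-diagonal left piece equals
`p · Σ_s WTT(s) · Φ⁰(s + e_ι)` (`WTT = diagWTT`: the exit triangle weighted on its line `{z ↔ x}`; `Φ⁰ = openBubbleAt`).
(GAPS G-D98: the off-diagonal addend `rawLOffDiag` only — the diagonal `t = 𝐞 ι` is the separate addend `rawLDiag`,
carried and priced on its own, and is not bounded here.)
[cite: FitznerVanDerHofstad2017, App. C.1, left-trivial sentence (arXiv:1506.07977v2 p. 80); App. B pp. 73, 78; §5.1 Table "P^{E,b}" (p. 47); Lemma 5.1 second version (p. 50)] -/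
theorem perc_offDiagL_two_termX_eq (ι : Fin d × Bool) :
    ∑' x, ∑' t, ∑' z, wt (z - x) * (kdc t (𝐞 ι) *
        (blockAbar' (Letters.perc d p) ι 0 2 0 0 t z * blockPEn (Letters.perc d p) 2 (t - x) (z - x)))
      = ENNReal.ofReal p *
          ∑' s, diagWTT (Letters.perc d p) s * openBubbleAt (Letters.perc d p) (s + 𝐞 ι) := by
  calc ∑' x, ∑' t, ∑' z, wt (z - x) * (kdc t (𝐞 ι) *
          (blockAbar' (Letters.perc d p) ι 0 2 0 0 t z * blockPEn (Letters.perc d p) 2 (t - x) (z - x)))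
      = ∑' x, ∑' t, ∑' z, wt (z - x) * ((kdc t (𝐞 ι) * (ENNReal.ofReal p *
          ((Letters.perc d p).tau (.ge 1) z * (Letters.perc d p).tau (.ge 1) (t - 𝐞 ι)))) *
          (kdc (z - x) 0 * (kdc (t - x) 0 * (Letters.perc d p).T (.ge 1) (.ge 2) (.ge 1) (t - x) (z - x) 0))) := by
        refine tsum_congr fun x => tsum_congr fun t => tsum_congr fun z => ?_
        rw [blockPEn_two_eq, ← mul_assoc (kdc t (𝐞 ι)), perc_mask_mul_blockAbar'_zero_two_left]
    _ = ∑' s, ∑' z, (kdc (z - s) (𝐞 ι) * (ENNReal.ofReal p *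
          ((Letters.perc d p).tau (.ge 1) z * (Letters.perc d p).tau (.ge 1) (z - s - 𝐞 ι)))) *
          ∑' w, wt (z - (z - w)) * diagLIntegrand (Letters.perc d p) (.ge 2) s w :=
        tsum₃_exit_reindex (Letters.perc d p) (.ge 2) (fun x z => wt (z - x))
          (fun t z => kdc t (𝐞 ι) * (ENNReal.ofReal p *
            ((Letters.perc d p).tau (.ge 1) z * (Letters.perc d p).tau (.ge 1) (t - 𝐞 ι))))
    _ = ∑' s, diagWTT (Letters.perc d p) s * (ENNReal.ofReal p *
          ∑' z, kdc (z - s) (𝐞 ι) * ((Letters.perc d p).tau (.ge 1) z *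
            (Letters.perc d p).tau (.ge 1) (z - s - 𝐞 ι))) := by
        refine tsum_congr fun s => ?_
        have hW : ∀ z : Site d, ∑' w, wt (z - (z - w)) * diagLIntegrand (Letters.perc d p) (.ge 2) s w
            = diagWTT (Letters.perc d p) s := by
          intro z
          simp only [sub_sub_cancel]
          rfl
        simp only [hW]
        rw [← ENNReal.tsum_mul_left, ← ENNReal.tsum_mul_left]
        exact tsum_congr fun z => by ring
    _ = _ := by
        rw [← ENNReal.tsum_mul_left]
        refine tsum_congr fun s => ?_
        rw [perc_tsum_mask_tau_tau]
        ring

/-- **Class `2` — the off-diagonal left piece, bounded** (split of weight through `z`; both terms exact):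
`rawLOffDiag (Ā') (P^E−u⃗) ι 2 ≤ 2p · Σ_s TT₂(s) Φ(s+e_ι) + 2p · Σ_s WTT(s) Φ⁰(s+e_ι)`.
(GAPS G-D98: the off-diagonal addend `rawLOffDiag` only — the diagonal `t = 𝐞 ι` is the separate addend `rawLDiag`,
carried and priced on its own, and is not bounded here.)
[cite: FitznerVanDerHofstad2017, App. C.1 (C.1) and the left-trivial sentence (arXiv:1506.07977v2 pp. 79–80); Lemma 5.1 second version (p. 50); §4.4 (4.65) (p. 43)] -/
theorem perc_rawLOffDiag_two_le (ι : Fin d × Bool) :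
    rawLOffDiag (blockAbar' (Letters.perc d p)) (blockPEn (Letters.perc d p)) ι 2
      ≤ 2 * (ENNReal.ofReal p *
          ∑' s, diagLTT (Letters.perc d p) (.ge 2) s * wtOpenBubbleAt (Letters.perc d p) (s + 𝐞 ι)) +
        2 * (ENNReal.ofReal p *
          ∑' s, diagWTT (Letters.perc d p) s * openBubbleAt (Letters.perc d p) (s + 𝐞 ι)) := by
  refine (rawLOffDiag_le_two_split _ _ ι 2).trans_eq ?_
  rw [perc_offDiagL_two_termW_eq, perc_offDiagL_two_termX_eq]

/-- **Class `2` in product form**: `TT₂(s) ≤ τ₂(s) Φ⁰(s)` and `WTT(s) ≤ τ₂(s) Φ(s)` (`𝓣 ≤ 𝓣*` on the exit letter) give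
`rawLOffDiag (Ā') (P^E−u⃗) ι 2 ≤ 2p · Σ_s τ₂(s) Φ⁰(s) Φ(s+e_ι) + 2p · Σ_s τ₂(s) Φ(s) Φ⁰(s+e_ι)` — the index `≥ 2`
on `s = z − t`, the doubled side of the exit triangle.
(GAPS G-D98: the off-diagonal addend `rawLOffDiag` only — the diagonal `t = 𝐞 ι` is the separate addend `rawLDiag`,
carried and priced on its own, and is not bounded here.)
[cite: FitznerVanDerHofstad2017, App. C.1, left-trivial sentence (arXiv:1506.07977v2 p. 80); §4.2 (4.8), (4.14)–(4.17) (pp. 34–36); Lemma 5.1 second version (p. 50)] -/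
theorem perc_rawLOffDiag_two_le_prod (ι : Fin d × Bool) :
    rawLOffDiag (blockAbar' (Letters.perc d p)) (blockPEn (Letters.perc d p)) ι 2
      ≤ 2 * (ENNReal.ofReal p * ∑' s, (Letters.perc d p).tau (.ge 2) s * openBubbleAt (Letters.perc d p) s
            * wtOpenBubbleAt (Letters.perc d p) (s + 𝐞 ι)) +
        2 * (ENNReal.ofReal p * ∑' s, (Letters.perc d p).tau (.ge 2) s * wtOpenBubbleAt (Letters.perc d p) s
            * openBubbleAt (Letters.perc d p) (s + 𝐞 ι)) := by
  refine (perc_rawLOffDiag_two_le p ι).trans (add_le_add ?_ ?_)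
  · exact mul_le_mul' le_rfl (mul_le_mul' le_rfl
      (ENNReal.tsum_le_tsum fun s => mul_le_mul' (perc_diagLTT_le p (.ge 2) s) le_rfl))
  · exact mul_le_mul' le_rfl (mul_le_mul' le_rfl
      (ENNReal.tsum_le_tsum fun s => mul_le_mul' (perc_diagWTT_le p s) le_rfl))

/-! ## D. Percolation, class `b = 1`: `rawLOffDiag (Ā') (P^E−u⃗) ι 1` -/

/-- **TERM W of class `1`, bounded**: `Σ ‖z‖₂² (…) ≤ Σ_s τ_{1̲}(s) · TT_{1̲}(s) · Φ(s + e_ι)` (`𝓢 ≤ 𝓢*` on the left square,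
`p⁻¹ p ≤ 1`; the bond `τ_{1̲}(s)`, `s = z − t`, is the square's third side, so `|s| = 1` is forced).
(GAPS G-D98: the off-diagonal addend `rawLOffDiag` only — the diagonal `t = 𝐞 ι` is the separate addend `rawLDiag`,
carried and priced on its own, and is not bounded here.)
[cite: FitznerVanDerHofstad2017, App. C.1, left-trivial sentence (arXiv:1506.07977v2 p. 80); App. B pp. 73, 75, 78; §4.2 (4.9), (4.14)–(4.17) (pp. 34–36); Lemma 5.1 second version (p. 50)] -/
theorem perc_offDiagL_one_termW_le (ι : Fin d × Bool) :
    ∑' x, ∑' t, ∑' z, wt z * (kdc t (𝐞 ι) *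
        (blockAbar' (Letters.perc d p) ι 0 1 0 0 t z * blockPEn (Letters.perc d p) 1 (t - x) (z - x)))
      ≤ ∑' s, (Letters.perc d p).tau (.eq 1) s * diagLTT (Letters.perc d p) (.eq 1) s
          * wtOpenBubbleAt (Letters.perc d p) (s + 𝐞 ι) := by
  calc ∑' x, ∑' t, ∑' z, wt z * (kdc t (𝐞 ι) *
          (blockAbar' (Letters.perc d p) ι 0 1 0 0 t z * blockPEn (Letters.perc d p) 1 (t - x) (z - x)))
      ≤ ∑' x, ∑' t, ∑' z, wt z * ((kdc t (𝐞 ι) * ((Letters.perc d p).tau (.eq 1) (z - t) *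
          ((Letters.perc d p).tau (.ge 1) z * (Letters.perc d p).tau (.ge 1) (t - 𝐞 ι)))) *
          (kdc (z - x) 0 * (kdc (t - x) 0 * (Letters.perc d p).T (.ge 1) (.eq 1) (.ge 1) (t - x) (z - x) 0))) := by
        refine ENNReal.tsum_le_tsum fun x => ENNReal.tsum_le_tsum fun t => ENNReal.tsum_le_tsum fun z => ?_
        rw [blockPEn_one_eq, ← mul_assoc (kdc t (𝐞 ι))]
        exact mul_le_mul' le_rfl (mul_le_mul' (perc_mask_mul_blockAbar'_zero_one_left_le p ι t z) le_rfl)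
    _ = ∑' s, ∑' z, (kdc (z - s) (𝐞 ι) * ((Letters.perc d p).tau (.eq 1) (z - (z - s)) *
          ((Letters.perc d p).tau (.ge 1) z * (Letters.perc d p).tau (.ge 1) (z - s - 𝐞 ι)))) *
          ∑' w, wt z * diagLIntegrand (Letters.perc d p) (.eq 1) s w :=
        tsum₃_exit_reindex (Letters.perc d p) (.eq 1) (fun _ z => wt z)
          (fun t z => kdc t (𝐞 ι) * ((Letters.perc d p).tau (.eq 1) (z - t) *
            ((Letters.perc d p).tau (.ge 1) z * (Letters.perc d p).tau (.ge 1) (t - 𝐞 ι))))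
    _ = ∑' s, (Letters.perc d p).tau (.eq 1) s * diagLTT (Letters.perc d p) (.eq 1) s *
          ∑' z, kdc (z - s) (𝐞 ι) * ((Letters.perc d p).tau (.ge 1) z *
            (Letters.perc d p).tau (.ge 1) (z - s - 𝐞 ι)) * wt z := by
        refine tsum_congr fun s => ?_
        rw [← ENNReal.tsum_mul_left]
        refine tsum_congr fun z => ?_
        rw [ENNReal.tsum_mul_left, diagLTT, sub_sub_cancel]
        ring
    _ = _ := by
        refine tsum_congr fun s => ?_
        rw [perc_tsum_mask_tau_tau_wt]

/-- **TERM X of class `1`, bounded**: `Σ ‖z−x‖₂² (…) ≤ Σ_s τ_{1̲}(s) · WTB(s) · Φ⁰(s + e_ι)` (`WTB = diagWTB`: the class-`1`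
exit triangle weighted on its line `{z ↔ x}`).
(GAPS G-D98: the off-diagonal addend `rawLOffDiag` only — the diagonal `t = 𝐞 ι` is the separate addend `rawLDiag`,
carried and priced on its own, and is not bounded here.)
[cite: FitznerVanDerHofstad2017, App. C.1, left-trivial sentence (arXiv:1506.07977v2 p. 80); App. B pp. 73, 75, 78; §4.2 (4.9), (4.14)–(4.17) (pp. 34–36); Lemma 5.1 second version (p. 50)] -/
theorem perc_offDiagL_one_termX_le (ι : Fin d × Bool) :
    ∑' x, ∑' t, ∑' z, wt (z - x) * (kdc t (𝐞 ι) *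
        (blockAbar' (Letters.perc d p) ι 0 1 0 0 t z * blockPEn (Letters.perc d p) 1 (t - x) (z - x)))
      ≤ ∑' s, (Letters.perc d p).tau (.eq 1) s * diagWTB (Letters.perc d p) s
          * openBubbleAt (Letters.perc d p) (s + 𝐞 ι) := by
  calc ∑' x, ∑' t, ∑' z, wt (z - x) * (kdc t (𝐞 ι) *
          (blockAbar' (Letters.perc d p) ι 0 1 0 0 t z * blockPEn (Letters.perc d p) 1 (t - x) (z - x)))
      ≤ ∑' x, ∑' t, ∑' z, wt (z - x) * ((kdc t (𝐞 ι) * ((Letters.perc d p).tau (.eq 1) (z - t) *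
          ((Letters.perc d p).tau (.ge 1) z * (Letters.perc d p).tau (.ge 1) (t - 𝐞 ι)))) *
          (kdc (z - x) 0 * (kdc (t - x) 0 * (Letters.perc d p).T (.ge 1) (.eq 1) (.ge 1) (t - x) (z - x) 0))) := by
        refine ENNReal.tsum_le_tsum fun x => ENNReal.tsum_le_tsum fun t => ENNReal.tsum_le_tsum fun z => ?_
        rw [blockPEn_one_eq, ← mul_assoc (kdc t (𝐞 ι))]
        exact mul_le_mul' le_rfl (mul_le_mul' (perc_mask_mul_blockAbar'_zero_one_left_le p ι t z) le_rfl)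
    _ = ∑' s, ∑' z, (kdc (z - s) (𝐞 ι) * ((Letters.perc d p).tau (.eq 1) (z - (z - s)) *
          ((Letters.perc d p).tau (.ge 1) z * (Letters.perc d p).tau (.ge 1) (z - s - 𝐞 ι)))) *
          ∑' w, wt (z - (z - w)) * diagLIntegrand (Letters.perc d p) (.eq 1) s w :=
        tsum₃_exit_reindex (Letters.perc d p) (.eq 1) (fun x z => wt (z - x))
          (fun t z => kdc t (𝐞 ι) * ((Letters.perc d p).tau (.eq 1) (z - t) *
            ((Letters.perc d p).tau (.ge 1) z * (Letters.perc d p).tau (.ge 1) (t - 𝐞 ι))))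
    _ = ∑' s, (Letters.perc d p).tau (.eq 1) s * diagWTB (Letters.perc d p) s *
          ∑' z, kdc (z - s) (𝐞 ι) * ((Letters.perc d p).tau (.ge 1) z *
            (Letters.perc d p).tau (.ge 1) (z - s - 𝐞 ι)) := by
        refine tsum_congr fun s => ?_
        have hW : ∀ z : Site d, ∑' w, wt (z - (z - w)) * diagLIntegrand (Letters.perc d p) (.eq 1) s w
            = diagWTB (Letters.perc d p) s := by
          intro z
          simp only [sub_sub_cancel]
          rfl
        simp only [hW]
        simp only [sub_sub_cancel]
        rw [← ENNReal.tsum_mul_left]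
        exact tsum_congr fun z => by ring
    _ = _ := by
        refine tsum_congr fun s => ?_
        rw [perc_tsum_mask_tau_tau]

/-- **Class `1` — the off-diagonal left piece, bounded**:
`rawLOffDiag (Ā') (P^E−u⃗) ι 1 ≤ 2 · Σ_s τ_{1̲}(s) TT_{1̲}(s) Φ(s+e_ι) + 2 · Σ_s τ_{1̲}(s) WTB(s) Φ⁰(s+e_ι)`.
(GAPS G-D98: the off-diagonal addend `rawLOffDiag` only — the diagonal `t = 𝐞 ι` is the separate addend `rawLDiag`,
carried and priced on its own, and is not bounded here.)
[cite: FitznerVanDerHofstad2017, App. C.1 (C.1) and the left-trivial sentence (arXiv:1506.07977v2 pp. 79–80); Lemma 5.1 second version (p. 50); §4.4 (4.65) (p. 43)] -/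
theorem perc_rawLOffDiag_one_le (ι : Fin d × Bool) :
    rawLOffDiag (blockAbar' (Letters.perc d p)) (blockPEn (Letters.perc d p)) ι 1
      ≤ 2 * (∑' s, (Letters.perc d p).tau (.eq 1) s * diagLTT (Letters.perc d p) (.eq 1) s
            * wtOpenBubbleAt (Letters.perc d p) (s + 𝐞 ι)) +
        2 * (∑' s, (Letters.perc d p).tau (.eq 1) s * diagWTB (Letters.perc d p) s
            * openBubbleAt (Letters.perc d p) (s + 𝐞 ι)) := by
  refine (rawLOffDiag_le_two_split _ _ ι 1).trans (add_le_add ?_ ?_)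
  · exact mul_le_mul' le_rfl (perc_offDiagL_one_termW_le p ι)
  · exact mul_le_mul' le_rfl (perc_offDiagL_one_termX_le p ι)

/-- **Class `1` in product form**: `TT_{1̲}(s) ≤ τ_{1̲}(s) Φ⁰(s)`, `WTB(s) ≤ τ_{1̲}(s) Φ(s)` give
`rawLOffDiag (Ā') (P^E−u⃗) ι 1 ≤ 2 · Σ_s τ_{1̲}(s)² Φ⁰(s) Φ(s+e_ι) + 2 · Σ_s τ_{1̲}(s)² Φ(s) Φ⁰(s+e_ι)` (`τ_{1̲}(s)`
vanishes unless `s` is a unit vector: the direction sum of the left analogue of Case c)).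
(GAPS G-D98: the off-diagonal addend `rawLOffDiag` only — the diagonal `t = 𝐞 ι` is the separate addend `rawLDiag`,
carried and priced on its own, and is not bounded here.)
[cite: FitznerVanDerHofstad2017, App. C.1, left-trivial sentence (arXiv:1506.07977v2 p. 80); §4.2 (4.8), (4.14)–(4.17) (pp. 34–36); Lemma 5.1 second version (p. 50)] -/
theorem perc_rawLOffDiag_one_le_prod (ι : Fin d × Bool) :
    rawLOffDiag (blockAbar' (Letters.perc d p)) (blockPEn (Letters.perc d p)) ι 1
      ≤ 2 * (∑' s, (Letters.perc d p).tau (.eq 1) s *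
            ((Letters.perc d p).tau (.eq 1) s * openBubbleAt (Letters.perc d p) s)
            * wtOpenBubbleAt (Letters.perc d p) (s + 𝐞 ι)) +
        2 * (∑' s, (Letters.perc d p).tau (.eq 1) s *
            ((Letters.perc d p).tau (.eq 1) s * wtOpenBubbleAt (Letters.perc d p) s)
            * openBubbleAt (Letters.perc d p) (s + 𝐞 ι)) := by
  refine (perc_rawLOffDiag_one_le p ι).trans (add_le_add ?_ ?_)
  · exact mul_le_mul' le_rfl (ENNReal.tsum_le_tsum fun s =>
      mul_le_mul' (mul_le_mul' le_rfl (perc_diagLTT_le p (.eq 1) s)) le_rfl)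
  · exact mul_le_mul' le_rfl (ENNReal.tsum_le_tsum fun s =>
      mul_le_mul' (mul_le_mul' le_rfl (perc_diagWTB_le p s)) le_rfl)

end Perc

/-! ## E. The direction `ι` summed inside (class `b = 2`): the `K̃`-bubbles -/

section DirSum

open _root_.MeasureTheory
open Literature.Probability.FitznerVanDerHofstad2017.NobleBlocks.LenIdx
open Literature.Probability.FitznerVanDerHofstad2017.UnitVectorPairs (opp opp_opp)
open Literature.Barriers.CriticalPhenomena
open Literature.Barriers.CriticalPhenomena.SpreadOutIsing (latticeConv)

/-! ### E.0 The direction sum is symmetric under `e ↦ −e` -/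

/-- `e_{opp κ} = −e_κ`. [folklore] -/
private theorem stepVec_opp'' (κ : Fin d × Bool) : (𝐞 (opp κ) : Site d) = -𝐞 κ := by
  rcases κ with ⟨i, b⟩
  cases b <;> simp [Percolation.stepVec, opp]

/-- `Σ_ι f(v − e_ι) = Σ_ι f(v + e_ι)` (reindex the `2d` directions by `ι ↦ opp ι`). [folklore] -/
private theorem sum_apply_sub_stepVec_eq {α : Type*} [AddCommMonoid α] (f : Site d → α) (v : Site d) :
    ∑ ι : Fin d × Bool, f (v - 𝐞 ι) = ∑ ι : Fin d × Bool, f (v + 𝐞 ι) := by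
  refine Fintype.sum_equiv ⟨opp, opp, opp_opp, opp_opp⟩ _ _ fun ι => ?_
  show f (v - 𝐞 ι) = f (v + 𝐞 (opp ι))
  rw [stepVec_opp'', ← sub_eq_add_neg]

/-! ### E.1 The `K̃`-bubbles (every letter table `L`) -/

/-- **The weighted `K̃`-bubble** `Φ^K_L(s) := Σ_w ‖w‖₂² τ_{≥1}(w) K̃_L(w − s)`, `K̃_L(y) = p Σ_ι τ_{≥1}(y + e_ι)`
(`NobleWeightedDiagLeft.diagKtilde`): the weighted open bubble `Φ_L` of §5.1 whose second line is continued by the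
pivotal bond `(0,e_ι)` (exact, summed over the `2d` directions) and a line of length `≥ 1` — the product-form (`T*`)
companion of the second member of `H₂` of (Hi-defs).
(G-D98-neutral: a definition over the letter table, independent of the diagonal split.)
[cite: FitznerVanDerHofstad2017, §5.1 "Elements of the bounds", weighted open bubble (arXiv:1506.07977v2 p. 49); §5.2 (Hi-defs) (p. 50); App. B row Ā^{ι,0,2} (p. 78); §4.4 (4.65), the sum over ι (p. 43)] -/
def wtKBubbleAt (L : Letters d) (s : Site d) : ℝ≥0∞ :=
  ∑' w, wt w * (L.tau (.ge 1) w * diagKtilde L (w - s))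

/-- **The plain `K̃`-bubble** `Φ^{K,0}_L(s) := Σ_w τ_{≥1}(w) K̃_L(w − s)` (no weight).
(G-D98-neutral: a definition over the letter table, independent of the diagonal split.)
[cite: FitznerVanDerHofstad2017, §4.2 (4.1), (4.7) (arXiv:1506.07977v2 p. 34); App. B row Ā^{ι,0,2} (p. 78); §4.4 (4.65), the sum over ι (p. 43)] -/
def kBubbleAt (L : Letters d) (s : Site d) : ℝ≥0∞ :=
  ∑' w, L.tau (.ge 1) w * diagKtilde L (w - s)

/-- **`sup_{s ≠ 0} Φ^K_L(s)`** — the supremum of the weighted `K̃`-bubble over the non-zero displacements (the shape of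
`sup_{x≠0} H_n(x)` of the display after (HD-def)).
(G-D98-neutral: a definition over the letter table, independent of the diagonal split.)
[cite: FitznerVanDerHofstad2017, §5.2 (Hi-defs) and the display after (HD-def) (arXiv:1506.07977v2 p. 50)] -/
def wtKBubbleSup (L : Letters d) : ℝ≥0∞ := ⨆ s : Site d, ⨆ (_ : s ≠ 0), wtKBubbleAt L s

/-- `Φ^K_L(s) ≤ sup_{s≠0} Φ^K_L` for `s ≠ 0`.
(G-D98-neutral: independent of the diagonal split.)
[cite: FitznerVanDerHofstad2017, §5.2, display after (HD-def) (arXiv:1506.07977v2 p. 50)] -/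
theorem wtKBubbleAt_le_wtKBubbleSup (L : Letters d) {s : Site d} (hs : s ≠ 0) :
    wtKBubbleAt L s ≤ wtKBubbleSup L :=
  le_iSup₂_of_le (f := fun (s : Site d) (_ : s ≠ 0) => wtKBubbleAt L s) s hs le_rfl

/-! ### E.2 Taking the direction sum inside the displaced bubbles (every letter table `L`, identities) -/

/-- **`p · Σ_ι τ_{≥1}(w − (s + e_ι)) = K̃_L(w − s)`** (the direction sum is symmetric under `e_ι ↦ −e_ι`).
(G-D98-neutral: a reindexing identity, independent of the diagonal split.)
[cite: FitznerVanDerHofstad2017, §4.4 (4.65), the sum over ι (arXiv:1506.07977v2 p. 43); §4.2 (4.1) (p. 34)] -/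
theorem p_mul_sum_tau_sub_add_stepVec (L : Letters d) (w s : Site d) :
    L.p * ∑ ι : Fin d × Bool, L.tau (.ge 1) (w - (s + 𝐞 ι)) = diagKtilde L (w - s) := by
  rw [diagKtilde, ← sum_apply_sub_stepVec_eq (L.tau (.ge 1)) (w - s)]
  refine congrArg _ (Finset.sum_congr rfl fun ι _ => ?_)
  show L.tau (.ge 1) (w - (s + 𝐞 ι)) = L.tau (.ge 1) (w - s - 𝐞 ι)
  rw [sub_sub]

/-- **`Σ_ι p · Φ_L(s + e_ι) = Φ^K_L(s)`**: the direction sum of the displaced weighted open bubbles is the weighted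
`K̃`-bubble (Fubini for non-negative series and `p_mul_sum_tau_sub_add_stepVec`).
(G-D98-neutral: an identity over the letter table, independent of the diagonal split.)
[cite: FitznerVanDerHofstad2017, §5.1 "Elements of the bounds", weighted open bubble (arXiv:1506.07977v2 p. 49); §4.4 (4.65), the sum over ι (p. 43)] -/
theorem sum_p_mul_wtOpenBubbleAt_add_stepVec (L : Letters d) (s : Site d) :
    ∑ ι : Fin d × Bool, L.p * wtOpenBubbleAt L (s + 𝐞 ι) = wtKBubbleAt L s := by
  calc ∑ ι : Fin d × Bool, L.p * wtOpenBubbleAt L (s + 𝐞 ι)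
      = ∑ ι : Fin d × Bool, ∑' w, wt w * (L.tau (.ge 1) w * (L.p * L.tau (.ge 1) (w - (s + 𝐞 ι)))) := by
        refine Finset.sum_congr rfl fun ι _ => ?_
        rw [wtOpenBubbleAt, ← ENNReal.tsum_mul_left]
        exact tsum_congr fun w => by ring
    _ = ∑' w, ∑ ι : Fin d × Bool, wt w * (L.tau (.ge 1) w * (L.p * L.tau (.ge 1) (w - (s + 𝐞 ι)))) :=
        (tsum_finsetSum _ _).symm
    _ = wtKBubbleAt L s := by
        rw [wtKBubbleAt]
        refine tsum_congr fun w => ?_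
        rw [← Finset.mul_sum, ← Finset.mul_sum, ← Finset.mul_sum, p_mul_sum_tau_sub_add_stepVec]

/-- **`Σ_ι p · Φ⁰_L(s + e_ι) = Φ^{K,0}_L(s)`**: the same for the plain open bubble `openBubbleAt`.
(G-D98-neutral: an identity over the letter table, independent of the diagonal split.)
[cite: FitznerVanDerHofstad2017, §4.2 (4.1), (4.7) (arXiv:1506.07977v2 p. 34); §4.4 (4.65), the sum over ι (p. 43)] -/
theorem sum_p_mul_openBubbleAt_add_stepVec (L : Letters d) (s : Site d) :
    ∑ ι : Fin d × Bool, L.p * openBubbleAt L (s + 𝐞 ι) = kBubbleAt L s := by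
  calc ∑ ι : Fin d × Bool, L.p * openBubbleAt L (s + 𝐞 ι)
      = ∑ ι : Fin d × Bool, ∑' w, L.tau (.ge 1) w * (L.p * L.tau (.ge 1) (w - (s + 𝐞 ι))) := by
        refine Finset.sum_congr rfl fun ι _ => ?_
        rw [openBubbleAt, ← ENNReal.tsum_mul_left]
        exact tsum_congr fun w => by ring
    _ = ∑' w, ∑ ι : Fin d × Bool, L.tau (.ge 1) w * (L.p * L.tau (.ge 1) (w - (s + 𝐞 ι))) :=
        (tsum_finsetSum _ _).symm
    _ = kBubbleAt L s := by
        rw [kBubbleAt]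
        refine tsum_congr fun w => ?_
        rw [← Finset.mul_sum, ← Finset.mul_sum, p_mul_sum_tau_sub_add_stepVec]

/-- **Direction sum against any co-factor**: `Σ_ι p Σ_s F(s) Φ_L(s + e_ι) = Σ_s F(s) Φ^K_L(s)`.
(G-D98-neutral: an identity over the letter table, independent of the diagonal split.)
[cite: FitznerVanDerHofstad2017, §4.4 (4.65), the sum over ι (arXiv:1506.07977v2 p. 43); §5.1 "Elements of the bounds" (p. 49)] -/
theorem sum_p_mul_tsum_mul_wtOpenBubbleAt_add_stepVec (L : Letters d) (F : Site d → ℝ≥0∞) :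
    ∑ ι : Fin d × Bool, L.p * ∑' s, F s * wtOpenBubbleAt L (s + 𝐞 ι) = ∑' s, F s * wtKBubbleAt L s := by
  calc ∑ ι : Fin d × Bool, L.p * ∑' s, F s * wtOpenBubbleAt L (s + 𝐞 ι)
      = ∑ ι : Fin d × Bool, ∑' s, F s * (L.p * wtOpenBubbleAt L (s + 𝐞 ι)) := by
        refine Finset.sum_congr rfl fun ι _ => ?_
        rw [← ENNReal.tsum_mul_left]
        exact tsum_congr fun s => by ring
    _ = ∑' s, ∑ ι : Fin d × Bool, F s * (L.p * wtOpenBubbleAt L (s + 𝐞 ι)) := (tsum_finsetSum _ _).symm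
    _ = ∑' s, F s * wtKBubbleAt L s :=
        tsum_congr fun s => by rw [← Finset.mul_sum, sum_p_mul_wtOpenBubbleAt_add_stepVec]

/-- **Direction sum against any co-factor, plain bubble**: `Σ_ι p Σ_s F(s) Φ⁰_L(s + e_ι) = Σ_s F(s) Φ^{K,0}_L(s)`.
(G-D98-neutral: an identity over the letter table, independent of the diagonal split.)
[cite: FitznerVanDerHofstad2017, §4.4 (4.65), the sum over ι (arXiv:1506.07977v2 p. 43); §4.2 (4.7) (p. 34)] -/
theorem sum_p_mul_tsum_mul_openBubbleAt_add_stepVec (L : Letters d) (F : Site d → ℝ≥0∞) :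
    ∑ ι : Fin d × Bool, L.p * ∑' s, F s * openBubbleAt L (s + 𝐞 ι) = ∑' s, F s * kBubbleAt L s := by
  calc ∑ ι : Fin d × Bool, L.p * ∑' s, F s * openBubbleAt L (s + 𝐞 ι)
      = ∑ ι : Fin d × Bool, ∑' s, F s * (L.p * openBubbleAt L (s + 𝐞 ι)) := by
        refine Finset.sum_congr rfl fun ι _ => ?_
        rw [← ENNReal.tsum_mul_left]
        exact tsum_congr fun s => by ring
    _ = ∑' s, ∑ ι : Fin d × Bool, F s * (L.p * openBubbleAt L (s + 𝐞 ι)) := (tsum_finsetSum _ _).symm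
    _ = ∑' s, F s * kBubbleAt L s :=
        tsum_congr fun s => by rw [← Finset.mul_sum, sum_p_mul_openBubbleAt_add_stepVec]

/-! ### E.3 Percolation, class `b = 2`: the direction-summed off-diagonal left piece -/

section PercDir

variable (p : unitInterval)

/-- A repulsive triangle whose second line is a point-to-itself line of length `≥ 1` vanishes:
`𝓣_{j₁,j₂,j₃}(x₁,x₁,x₃) = 0` when the number of `j₂` is `≥ 1` (`{v ←j→ v} = ∅`).  (Private copy of
`NobleWeightedOffDiagRight.perc_T_self₂_eq_zero`, which this module does not import.)
[cite: FitznerVanDerHofstad2017, §4.2 (4.1), (4.17) (arXiv:1506.07977v2 pp. 34–36)] -/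
private theorem perc_T_self₂_eq_zero' {j₂ : LenIdx} (hj : floor j₂ ≠ 0) (j₁ j₃ : LenIdx) (x₁ x₃ : Site d) :
    (Letters.perc d p).T j₁ j₂ j₃ x₁ x₁ x₃ = 0 := by
  rw [perc_T]
  refine repLetter_eq_zero_of_null p _ 1 (isUpperSet_event j₂ x₁ x₁) ?_
  have h : (lineEvents₃ j₁ j₂ j₃ x₁ x₁ x₃ 1) = ∅ := by
    show (event j₂ x₁ x₁ : Set (BondConfig (Site d))) = ∅
    exact event_self_eq_empty hj x₁
  rw [h, measure_empty]

/-- **`TT_j(0) = 0`** when the number of `j` is `≥ 1`: at middle displacement `y = 0` the exit triangle's middle line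
is a point-to-itself line `w ←j→ w`.
(G-D98-neutral: a letter identity independent of the diagonal split.)
[cite: FitznerVanDerHofstad2017, §4.2 (4.1), (4.17) (arXiv:1506.07977v2 pp. 34–36); App. B Table "definition of P^b(x,y)" (p. 73)] -/
theorem perc_diagLTT_zero {j : LenIdx} (hj : floor j ≠ 0) : diagLTT (Letters.perc d p) j 0 = 0 := by
  rw [diagLTT]
  refine ENNReal.tsum_eq_zero.mpr fun w => ?_
  rw [diagLIntegrand, sub_zero, perc_T_self₂_eq_zero' p hj, mul_zero, mul_zero]

/-- `Σ_ι p Σ_s F(s) Φ(s + e_ι) = Σ_s F(s) Φ^K(s)` at `Letters.perc` (`p` displayed as `ofReal p`).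
(G-D98-neutral: an identity independent of the diagonal split.)
[cite: FitznerVanDerHofstad2017, §4.4 (4.65), the sum over ι (arXiv:1506.07977v2 p. 43); §5.1 "Elements of the bounds" (p. 49)] -/
theorem perc_sum_tsum_mul_wtOpenBubbleAt_add_stepVec (F : Site d → ℝ≥0∞) :
    ∑ ι : Fin d × Bool, ENNReal.ofReal p * ∑' s, F s * wtOpenBubbleAt (Letters.perc d p) (s + 𝐞 ι)
      = ∑' s, F s * wtKBubbleAt (Letters.perc d p) s :=
  sum_p_mul_tsum_mul_wtOpenBubbleAt_add_stepVec (Letters.perc d p) F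

/-- `Σ_ι p Σ_s F(s) Φ⁰(s + e_ι) = Σ_s F(s) Φ^{K,0}(s)` at `Letters.perc` (`p` displayed as `ofReal p`).
(G-D98-neutral: an identity independent of the diagonal split.)
[cite: FitznerVanDerHofstad2017, §4.4 (4.65), the sum over ι (arXiv:1506.07977v2 p. 43); §4.2 (4.7) (p. 34)] -/
theorem perc_sum_tsum_mul_openBubbleAt_add_stepVec (F : Site d → ℝ≥0∞) :
    ∑ ι : Fin d × Bool, ENNReal.ofReal p * ∑' s, F s * openBubbleAt (Letters.perc d p) (s + 𝐞 ι)
      = ∑' s, F s * kBubbleAt (Letters.perc d p) s :=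
  sum_p_mul_tsum_mul_openBubbleAt_add_stepVec (Letters.perc d p) F

/-- **Class `2`, summed over the direction — exit letters kept whole**:
`Σ_ι rawLOffDiag (Ā') (P^E−u⃗) ι 2 ≤ 2 Σ_s TT₂(s) Φ^K(s) + 2 Σ_s WTT(s) Φ^{K,0}(s)` (the split of weight through `z`
per direction, `perc_rawLOffDiag_two_le` (§C), then the direction sum taken inside the displaced
bubbles).
(GAPS G-D98: the off-diagonal addend `rawLOffDiag` only — the diagonal `t = 𝐞 ι` is the separate addend `rawLDiag`,
carried and priced on its own, and is not bounded here.)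
[cite: FitznerVanDerHofstad2017, §4.4 (4.65), the sum over ι (arXiv:1506.07977v2 p. 43); App. C.1 (C.1) and the left-trivial sentence (pp. 79–80); Lemma 5.1 second version (p. 50)] -/
theorem perc_sum_rawLOffDiag_two_le_dir :
    ∑ ι : Fin d × Bool, rawLOffDiag (blockAbar' (Letters.perc d p)) (blockPEn (Letters.perc d p)) ι 2
      ≤ 2 * (∑' s, diagLTT (Letters.perc d p) (.ge 2) s * wtKBubbleAt (Letters.perc d p) s) +
        2 * (∑' s, diagWTT (Letters.perc d p) s * kBubbleAt (Letters.perc d p) s) := by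
  calc ∑ ι : Fin d × Bool, rawLOffDiag (blockAbar' (Letters.perc d p)) (blockPEn (Letters.perc d p)) ι 2
      ≤ ∑ ι : Fin d × Bool, (2 * (ENNReal.ofReal p *
            ∑' s, diagLTT (Letters.perc d p) (.ge 2) s * wtOpenBubbleAt (Letters.perc d p) (s + 𝐞 ι)) +
          2 * (ENNReal.ofReal p *
            ∑' s, diagWTT (Letters.perc d p) s * openBubbleAt (Letters.perc d p) (s + 𝐞 ι))) :=
        Finset.sum_le_sum fun ι _ => perc_rawLOffDiag_two_le p ι
    _ = 2 * (∑ ι : Fin d × Bool, ENNReal.ofReal p *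
            ∑' s, diagLTT (Letters.perc d p) (.ge 2) s * wtOpenBubbleAt (Letters.perc d p) (s + 𝐞 ι)) +
          2 * (∑ ι : Fin d × Bool, ENNReal.ofReal p *
            ∑' s, diagWTT (Letters.perc d p) s * openBubbleAt (Letters.perc d p) (s + 𝐞 ι)) := by
        rw [Finset.sum_add_distrib, Finset.mul_sum, Finset.mul_sum]
    _ = 2 * (∑' s, diagLTT (Letters.perc d p) (.ge 2) s * wtKBubbleAt (Letters.perc d p) s) +
          2 * (∑' s, diagWTT (Letters.perc d p) s * kBubbleAt (Letters.perc d p) s) := by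
        rw [perc_sum_tsum_mul_wtOpenBubbleAt_add_stepVec, perc_sum_tsum_mul_openBubbleAt_add_stepVec]

/-- **Extraction of `sup_{s≠0} Φ^K`**: `Σ_s TT₂(s) Φ^K(s) ≤ (sup_{s≠0} Φ^K(s)) · Σ_s TT₂(s)` — the member `s = 0`
vanishes (`TT₂(0) = 0`, `perc_diagLTT_zero`).
(G-D98-neutral: independent of the diagonal split.)
[cite: FitznerVanDerHofstad2017, §5.2 (Hi-defs), display after (HD-def) (arXiv:1506.07977v2 p. 50); Lemma 5.1 second version (p. 50)] -/
theorem perc_tsum_diagLTT_mul_wtKBubbleAt_le :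
    ∑' s, diagLTT (Letters.perc d p) (.ge 2) s * wtKBubbleAt (Letters.perc d p) s
      ≤ wtKBubbleSup (Letters.perc d p) * ∑' s, diagLTT (Letters.perc d p) (.ge 2) s := by
  rw [← ENNReal.tsum_mul_left]
  refine ENNReal.tsum_le_tsum fun s => ?_
  by_cases hs : s = 0
  · subst hs
    rw [perc_diagLTT_zero p (j := .ge 2) two_ne_zero, zero_mul, mul_zero]
  · rw [mul_comm (wtKBubbleSup _)]
    exact mul_le_mul' le_rfl (wtKBubbleAt_le_wtKBubbleSup _ hs)

/-- **Product form of the `WTT`-term**: `Σ_s WTT(s) Φ^{K,0}(s) ≤ Σ_s τ₂(s) Φ(s) Φ^{K,0}(s)` (`WTT(s) ≤ τ₂(s) Φ(s)`,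
`NobleWeightedDiagRight.perc_diagWTT_le`: `𝓣 ≤ 𝓣*` on the exit letter; the index `≥ 2` on `s`).
(G-D98-neutral: independent of the diagonal split.)
[cite: FitznerVanDerHofstad2017, §4.2 (4.8), (4.14)–(4.17) (arXiv:1506.07977v2 pp. 34–36); Lemma 5.1 second version (p. 50)] -/
theorem perc_tsum_diagWTT_mul_kBubbleAt_le :
    ∑' s, diagWTT (Letters.perc d p) s * kBubbleAt (Letters.perc d p) s
      ≤ ∑' s, (Letters.perc d p).tau (.ge 2) s * wtOpenBubbleAt (Letters.perc d p) s
          * kBubbleAt (Letters.perc d p) s :=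
  ENNReal.tsum_le_tsum fun s => mul_le_mul' (perc_diagWTT_le p s) le_rfl

/-- **Class `2`, summed over the direction — supremum ∕ product form**:
`Σ_ι rawLOffDiag (Ā') (P^E−u⃗) ι 2 ≤ 2 (sup_{s≠0} Φ^K(s)) Σ_s TT₂(s) + 2 Σ_s τ₂(s) Φ(s) Φ^{K,0}(s)` — the first term
keeps the closed repulsive exit triangle `Σ_s TT₂(s) = Σ_{s,w} (1−δ_{w,0})(1−δ_{w−s,0}) 𝓣_{1,2,1}(w−s,w,0)` whole against
the supremum of the weighted `K̃`-bubble; the second is the `τ₂ · Φ · Φ^{K,0}` object.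
(GAPS G-D98: the off-diagonal addend `rawLOffDiag` only — the diagonal `t = 𝐞 ι` is the separate addend `rawLDiag`,
carried and priced on its own, and is not bounded here.)
[cite: FitznerVanDerHofstad2017, §4.4 (4.65), the sum over ι (arXiv:1506.07977v2 p. 43); App. C.1 (C.1) and the left-trivial sentence (pp. 79–80); §5.2 (Hi-defs), display after (HD-def) (p. 50); Lemma 5.1 second version (p. 50)] -/
theorem perc_sum_rawLOffDiag_two_le_sup :
    ∑ ι : Fin d × Bool, rawLOffDiag (blockAbar' (Letters.perc d p)) (blockPEn (Letters.perc d p)) ι 2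
      ≤ 2 * (wtKBubbleSup (Letters.perc d p) * ∑' s, diagLTT (Letters.perc d p) (.ge 2) s) +
        2 * (∑' s, (Letters.perc d p).tau (.ge 2) s * wtOpenBubbleAt (Letters.perc d p) s
          * kBubbleAt (Letters.perc d p) s) := by
  refine (perc_sum_rawLOffDiag_two_le_dir p).trans (add_le_add ?_ ?_)
  · exact mul_le_mul' le_rfl (perc_tsum_diagLTT_mul_wtKBubbleAt_le p)
  · exact mul_le_mul' le_rfl (perc_tsum_diagWTT_mul_kBubbleAt_le p)

/-! ### E.4 The pricing sentences for `K̃` (real side) -/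

/-- **`K̃(v) = 2dp · (D ⋆ τ_{≥1,p})(v)`** at `Letters.perc`, exactly: the direction sum is the neighbour sum
`Σ_κ G(e_κ + v) = 2d (D ⋆ G)(v)` (`sum_stepVec_add_eq_two_d_mul_latticeConv_srwStep`). `1 ≤ d`.
(G-D98-neutral: a letter identity independent of the diagonal split.)
[cite: FitznerVanDerHofstad2017, §4.2 (4.1), (4.3) (arXiv:1506.07977v2 p. 34); §4.4 (4.65), the sum over ι (p. 43)]
[cite: FitznerVanDerHofstad2016NoBLE, (1.1) (D(x) = 𝟙{|x| = 1}/(2d)); §5.3.1 (PTRF 169 (2017) p. 1093)] -/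
theorem perc_diagKtilde_eq_ofReal (hd : 1 ≤ d) (v : Site d) :
    diagKtilde (Letters.perc d p) v =
      ENNReal.ofReal (2 * d * (p : ℝ) * latticeConv (srwStep d) (tauGe d p 1) v) := by
  rw [diagKtilde, perc_p]
  calc ENNReal.ofReal p * ∑ ι : Fin d × Bool, (Letters.perc d p).tau (.ge 1) (v + 𝐞 ι)
      = ENNReal.ofReal p * ∑ ι : Fin d × Bool, ENNReal.ofReal (tauGe d p 1 (𝐞 ι + v)) :=
        congrArg _ (Finset.sum_congr rfl fun ι _ => by rw [perc_tau_ge, add_comm v])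
    _ = ENNReal.ofReal ((p : ℝ) * ∑ ι : Fin d × Bool, tauGe d p 1 (𝐞 ι + v)) := by
        rw [ENNReal.ofReal_mul p.2.1, ENNReal.ofReal_sum_of_nonneg fun ι _ => tauGe_nonneg p 1 (𝐞 ι + v)]
    _ = ENNReal.ofReal (2 * d * (p : ℝ) * latticeConv (srwStep d) (tauGe d p 1) v) := by
        rw [sum_stepVec_add_eq_two_d_mul_latticeConv_srwStep hd (tauGe d p 1) v]
        congr 1
        ring

/-- **`K̃(v) ≤ (2dp)² · (D ⋆ (D ⋆ τ_p))(v)`** at `Letters.perc`: on each of the `2d` lines, (4.3) `τ_{≥1,p} ≤ 2dp (D ⋆ τ_p)`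
(`tauGe_one_le_two_d_mul_latticeConv_tau`), then the neighbour sum `Σ_κ G(e_κ + v) = 2d (D ⋆ G)(v)`
(`sum_stepVec_add_eq_two_d_mul_latticeConv_srwStep`). `1 ≤ d`.
(G-D98-neutral: a letter bound independent of the diagonal split.)
[cite: FitznerVanDerHofstad2017, §4.2 (4.3) (arXiv:1506.07977v2 p. 34; EJP 22 (2017) no. 43 p. 31); §4.2 (4.10) (p. 35)]
[cite: FitznerVanDerHofstad2016NoBLE, (1.1) (D(x) = 𝟙{|x| = 1}/(2d)); §5.3.1 (PTRF 169 (2017) p. 1093)] -/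
theorem perc_diagKtilde_le_ofReal (hd : 1 ≤ d) (v : Site d) :
    diagKtilde (Letters.perc d p) v ≤ ENNReal.ofReal ((2 * d * (p : ℝ)) ^ 2 *
      latticeConv (srwStep d) (latticeConv (srwStep d) (tau d p 0)) v) := by
  have hG0 : ∀ z : Site d, 0 ≤ 2 * d * (p : ℝ) * latticeConv (srwStep d) (tau d p 0) z := fun z =>
    mul_nonneg (mul_nonneg (mul_nonneg zero_le_two (Nat.cast_nonneg d)) p.2.1)
      (latticeConv_nonneg (fun x => srwStep_nonneg x) (fun x => tau_nonneg p 0 x) z)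
  rw [diagKtilde, perc_p]
  calc ENNReal.ofReal p * ∑ ι : Fin d × Bool, (Letters.perc d p).tau (.ge 1) (v + 𝐞 ι)
      ≤ ENNReal.ofReal p * ∑ ι : Fin d × Bool,
          ENNReal.ofReal (2 * d * (p : ℝ) * latticeConv (srwStep d) (tau d p 0) (𝐞 ι + v)) := by
        refine mul_le_mul' le_rfl (Finset.sum_le_sum fun ι _ => ?_)
        rw [perc_tau_ge, add_comm v]
        exact ENNReal.ofReal_le_ofReal (tauGe_one_le_two_d_mul_latticeConv_tau hd p _)
    _ = ENNReal.ofReal ((p : ℝ) * ∑ ι : Fin d × Bool,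
          2 * d * (p : ℝ) * latticeConv (srwStep d) (tau d p 0) (𝐞 ι + v)) := by
        rw [ENNReal.ofReal_mul p.2.1, ENNReal.ofReal_sum_of_nonneg fun ι _ => hG0 (𝐞 ι + v)]
    _ = ENNReal.ofReal ((2 * d * (p : ℝ)) ^ 2 *
          latticeConv (srwStep d) (latticeConv (srwStep d) (tau d p 0)) v) := by
        rw [sum_stepVec_add_eq_two_d_mul_latticeConv_srwStep hd
          (fun z => 2 * d * (p : ℝ) * latticeConv (srwStep d) (tau d p 0) z) v, latticeConv_const_mul_right]
        ring_nf

end PercDir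

end DirSum

end Literature.Probability.FitznerVanDerHofstad2017

end
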